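import Literature.MathematicalPhysics.QuantumFieldTheory.ContinuumLimits
import Literature.MathematicalPhysics.QuantumLattice.SchwartzPartition
import Mathlib.Analysis.SpecialFunctions.Pow.Integral
import Mathlib.MeasureTheory.Measure.Lebesgue.EqHaar
import HarnessLib

/-!
# Off-diagonal non-degeneracy of a bounded two-point function

Sibling proofs file of `Literature/MathematicalPhysics/QuantumFieldTheory/ContinuumLimits.lean`
(theorems only; no statement of that file is changed, no named fact is introduced). It discharges
the named fact
`Literature.MathematicalPhysics.QuantumLattice.HasBoundedNondegenerateTwoPoint.hasPowerBoundedNondegenerateTwoPoint`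
(D-0014) as the theorem `…hasPowerBoundedNondegenerateTwoPoint_holds`: on `ℝᵈ = EuclideanSpace ℝ (Fin d)`,
`2 < d`, the hypothesis of Aizenman–Duminil-Copin 2021, Thm 1.2 in the A1 form
`HasBoundedNondegenerateTwoPoint μ` (second moments; `⟨ω(f)ω(g)⟩ = ∫∫ S₂(x,y) f(x) g(y)` for *all*
Schwartz `f, g`; `|S₂(x,y)| ≤ C‖x − y‖^{−(d−2)}`; `⟨ω(f₀)ω(g₀)⟩ ≠ 0` for some `f₀, g₀`) implies the
off-diagonal form `HasPowerBoundedNondegenerateTwoPoint μ` of `ContinuumLimits` (kernel representation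
and bound only off the diagonal, exponent `s = d − 2 > 0`, and a *compactly supported, disjointly
supported* pair `f, g` with `⟨ω(f)ω(g)⟩ ≠ 0`).

## Proof

Only the last clause needs an argument. The kernel `S₂` is not assumed measurable, so the sole
usable consequence of the kernel representation is the junk-robust bound
`|⟨ω(f)ω(g)⟩| ≤ C ∫ |f(x)| (∫ ‖x − y‖^{−s} |g(y)| dy) dx` (`norm_integral_le_integral_norm` and
`integral_mono_of_nonneg` against an integrable dominator; `abs_integral_mul_mul_le`,
`abs_integral_le_of_pointwise`).

* *Bilinearity.* Second moments make `twoPoint μ` additive in each slot (`twoPoint_sum_left/right`).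
* *Continuity.* With the locally integrable Riesz kernel `‖z‖^{−s}`, `s < d`
  (Mathlib `integrableOn_ball_of_norm_le_rpow`), `|⟨ω(f)ω(φ)⟩| ≤ C (c₁ ‖φ‖_∞ + ‖φ‖₁) ‖f‖₁`
  (`abs_twoPoint_le_of_sup`), so `⟨ω(f)ω(·)⟩` and `⟨ω(·)ω(f)⟩` are continuous along the cut-offs
  `W_R φ → φ` of `SchwartzPartition` (`tendsto_latticeWindow_smul`, convergence in `𝒮`, hence in
  sup norm and in `L¹` via Mathlib's `SchwartzMap.toLpCLM`): the non-degenerate pair may be taken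
  compactly supported (`exists_hasCompactSupport_twoPoint_ne_zero`).
* *Slabs.* For compactly supported `f, g` cut both by the one-dimensional partition of unity
  `ρ(L x₀ − k)`, `k ∈ ℤ` (`pouBump` of `SchwartzPartition`, first coordinate, width `1/L`):
  `⟨ω(f)ω(g)⟩ = ∑_{k,m} ⟨ω(f_k)ω(g_m)⟩`. Pieces with `|k − m| ≥ 3` have disjoint supports; the
  `≤ 5` neighbours `m` of each `k` contribute at most `C ‖g‖_∞ Ψ(L) ‖f_k‖₁` with
  `Ψ(L) = ∫_{‖z‖ ≤ 2R, |z₀| ≤ 4/L} ‖z‖^{−s} dz`, and `∑_k ‖f_k‖₁ = ‖f‖₁`. Since the slabs shrink to a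
  hyperplane (Lebesgue-null, `Measure.addHaar_submodule`), `Ψ(L) → 0`
  (`tendsto_setIntegral_of_antitone`), so for `L` large some far pair `(f_k, g_m)` has
  `⟨ω(f_k)ω(g_m)⟩ ≠ 0` (`exists_disjoint_twoPoint_ne_zero`).

## References

* M. Aizenman, H. Duminil-Copin, *Marginal triviality of the scaling limits of critical 4D Ising
  and `φ⁴₄` models*, Ann. Math. 194 (2021) 163–235, arXiv:1912.07973, §1.2–1.3 (Thm 1.2 and
  its bounded two-point function hypothesis; the infrared bound `⟨σₓσ_y⟩ ≤ C/|x−y|^{d−2}`,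
  arXiv p. 6) [AizenmanDuminilCopinAnnals2021].
  The implication proved here is an elementary covering argument (folklore), not printed there.

## Mathlib / tree

Mathlib: `integrableOn_ball_of_norm_le_rpow`, `Measure.addHaar_submodule`,
`tendsto_setIntegral_of_antitone`, `integral_sub_right_eq_self`, `Integrable.comp_sub_right`,
`HasCompactSupport.toSchwartzMap`, `SchwartzMap.smulLeftCLM`, `SchwartzMap.toLpCLM`,
`SchwartzMap.norm_toLp_one`, `MemLp.integrable_mul`. Tree: `pouBump`, `sum_Icc_pouBump`,
`pouWindow_eq_one`, `latticeWindow`, `tendsto_latticeWindow_smul`,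
`exists_bound_iteratedFDeriv_latticeWindow`, `hasTemperateGrowth_of_bounds`
(`QuantumLattice/SchwartzPartition`).
-/

noncomputable section

open MeasureTheory Filter Topology Set Metric
open scoped SchwartzMap ContDiff
open Literature.MathematicalPhysics.QuantumLattice

namespace Literature.MathematicalPhysics.QuantumFieldTheory

namespace TwoPointOffDiagonal

/-! ### Bilinearity of the two-point function under second moments -/

section Bilinear

variable {V : Type*} [NormedAddCommGroup V] [NormedSpace ℝ V] {μ : Measure (FieldConfig V)}

/-- Second moments make `ω(f) ω(g)` integrable (Cauchy–Schwarz). [folklore] -/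
theorem integrable_eval_mul_eval
    (h2 : ∀ f : 𝓢(V, ℝ), MemLp (fun w : FieldConfig V => w f) 2 μ) (f g : 𝓢(V, ℝ)) :
    Integrable (fun w : FieldConfig V => w f * w g) μ :=
  (h2 f).integrable_mul (h2 g)

/-- Additivity of `twoPoint μ` in the first slot. [folklore] -/
theorem twoPoint_add_left (h2 : ∀ f : 𝓢(V, ℝ), MemLp (fun w : FieldConfig V => w f) 2 μ)
    (f₁ f₂ g : 𝓢(V, ℝ)) :
    twoPoint μ (f₁ + f₂) g = twoPoint μ f₁ g + twoPoint μ f₂ g := by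
  simp only [twoPoint, map_add, add_mul]
  exact integral_add (integrable_eval_mul_eval h2 f₁ g) (integrable_eval_mul_eval h2 f₂ g)

/-- Additivity of `twoPoint μ` in the second slot. [folklore] -/
theorem twoPoint_add_right (h2 : ∀ f : 𝓢(V, ℝ), MemLp (fun w : FieldConfig V => w f) 2 μ)
    (f g₁ g₂ : 𝓢(V, ℝ)) :
    twoPoint μ f (g₁ + g₂) = twoPoint μ f g₁ + twoPoint μ f g₂ := by
  simp only [twoPoint, map_add, mul_add]
  exact integral_add (integrable_eval_mul_eval h2 f g₁) (integrable_eval_mul_eval h2 f g₂)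

/-- `twoPoint μ` respects subtraction in the first slot. [folklore] -/
theorem twoPoint_sub_left (h2 : ∀ f : 𝓢(V, ℝ), MemLp (fun w : FieldConfig V => w f) 2 μ)
    (f₁ f₂ g : 𝓢(V, ℝ)) :
    twoPoint μ (f₁ - f₂) g = twoPoint μ f₁ g - twoPoint μ f₂ g := by
  simp only [twoPoint, map_sub, sub_mul]
  exact integral_sub (integrable_eval_mul_eval h2 f₁ g) (integrable_eval_mul_eval h2 f₂ g)

/-- `twoPoint μ` respects subtraction in the second slot. [folklore] -/
theorem twoPoint_sub_right (h2 : ∀ f : 𝓢(V, ℝ), MemLp (fun w : FieldConfig V => w f) 2 μ)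
    (f g₁ g₂ : 𝓢(V, ℝ)) :
    twoPoint μ f (g₁ - g₂) = twoPoint μ f g₁ - twoPoint μ f g₂ := by
  simp only [twoPoint, map_sub, mul_sub]
  exact integral_sub (integrable_eval_mul_eval h2 f g₁) (integrable_eval_mul_eval h2 f g₂)

/-- `twoPoint μ` of a finite sum in the first slot. [folklore] -/
theorem twoPoint_sum_left (h2 : ∀ f : 𝓢(V, ℝ), MemLp (fun w : FieldConfig V => w f) 2 μ)
    {ι : Type*} (s : Finset ι) (f : ι → 𝓢(V, ℝ)) (g : 𝓢(V, ℝ)) :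
    twoPoint μ (∑ i ∈ s, f i) g = ∑ i ∈ s, twoPoint μ (f i) g := by
  classical
  induction s using Finset.induction_on with
  | empty => simp [twoPoint]
  | insert a s ha ih => rw [Finset.sum_insert ha, Finset.sum_insert ha, twoPoint_add_left h2, ih]

/-- `twoPoint μ` of a finite sum in the second slot. [folklore] -/
theorem twoPoint_sum_right (h2 : ∀ f : 𝓢(V, ℝ), MemLp (fun w : FieldConfig V => w f) 2 μ)
    {ι : Type*} (s : Finset ι) (f : 𝓢(V, ℝ)) (g : ι → 𝓢(V, ℝ)) :
    twoPoint μ f (∑ i ∈ s, g i) = ∑ i ∈ s, twoPoint μ f (g i) := by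
  classical
  induction s using Finset.induction_on with
  | empty => simp [twoPoint]
  | insert a s ha ih => rw [Finset.sum_insert ha, Finset.sum_insert ha, twoPoint_add_right h2, ih]

end Bilinear

/-! ### Junk-robust bounds for iterated kernel integrals -/

section RobustBounds

variable {Y : Type*} [MeasurableSpace Y] {ν : Measure Y}

/-- **Inner bound.** If `|K| ≤ C·B` pointwise and `B |g| ≤ D` with `D` integrable, then
`|∫ K(y) a g(y) dy| ≤ C |a| ∫ D` — valid for the Bochner integral whatever the measurability
or integrability of `K` (both sides vanish for `a = 0`; otherwise the two inequalities
`‖∫ F‖ ≤ ∫ ‖F‖ ≤ ∫ D'` need only the integrability of the dominator `D'`).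
[folklore] -/
theorem abs_integral_mul_mul_le {K B g D : Y → ℝ} {a C : ℝ} (hC : 0 ≤ C)
    (hK : ∀ y, |K y| ≤ C * B y) (hD : a ≠ 0 → ∀ y, B y * |g y| ≤ D y)
    (hDi : Integrable D ν) : |∫ y, K y * a * g y ∂ν| ≤ C * |a| * ∫ y, D y ∂ν := by
  rcases eq_or_ne a 0 with rfl | ha
  · simp
  calc |∫ y, K y * a * g y ∂ν| = ‖∫ y, K y * a * g y ∂ν‖ := (Real.norm_eq_abs _).symm
    _ ≤ ∫ y, ‖K y * a * g y‖ ∂ν := norm_integral_le_integral_norm _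
    _ ≤ ∫ y, C * |a| * D y ∂ν := by
        refine integral_mono_of_nonneg (Eventually.of_forall fun y => norm_nonneg _)
          (hDi.const_mul _) (Eventually.of_forall fun y => ?_)
        dsimp only
        rw [Real.norm_eq_abs, abs_mul, abs_mul]
        calc |K y| * |a| * |g y| ≤ C * B y * |a| * |g y| := by gcongr; exact hK y
          _ = C * |a| * (B y * |g y|) := by ring
          _ ≤ C * |a| * D y := mul_le_mul_of_nonneg_left (hD ha y) (by positivity)
    _ = C * |a| * ∫ y, D y ∂ν := integral_const_mul _ _

/-- **Outer bound.** If `|I(x)| ≤ M |f(x)|` pointwise with `f` integrable then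
`|∫ I| ≤ M ∫ |f|` (again regardless of the measurability of `I`). [folklore] -/
theorem abs_integral_le_of_pointwise {I f : Y → ℝ} {M : ℝ} (hI : ∀ x, |I x| ≤ M * |f x|)
    (hf : Integrable f ν) : |∫ x, I x ∂ν| ≤ M * ∫ x, |f x| ∂ν := by
  calc |∫ x, I x ∂ν| = ‖∫ x, I x ∂ν‖ := (Real.norm_eq_abs _).symm
    _ ≤ ∫ x, ‖I x‖ ∂ν := norm_integral_le_integral_norm _
    _ ≤ ∫ x, M * |f x| ∂ν :=
        integral_mono_of_nonneg (Eventually.of_forall fun x => norm_nonneg _) (hf.abs.const_mul M)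
          (Eventually.of_forall fun x => by dsimp only; rw [Real.norm_eq_abs]; exact hI x)
    _ = M * ∫ x, |f x| ∂ν := integral_const_mul _ _

end RobustBounds

/-! ### The Riesz kernel on `ℝᵈ` -/

section Riesz

variable {d : ℕ}

/-- The Riesz kernel `‖z‖^{-s}` is integrable on balls of `ℝᵈ` when `s < d` (`d ≥ 1`).
(Mathlib `integrableOn_ball_of_norm_le_rpow`, polar coordinates.) [folklore] -/
theorem integrableOn_norm_rpow_neg_ball (hd : 1 ≤ d) {s : ℝ} (hs : s < d) (r : ℝ) :
    IntegrableOn (fun z : EuclideanSpace ℝ (Fin d) => ‖z‖ ^ (-s)) (ball 0 r) volume := by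
  refine integrableOn_ball_of_norm_le_rpow (by rw [finrank_euclideanSpace_fin]; exact hd)
    (C := 1) (α := s) (by rw [finrank_euclideanSpace_fin]; exact_mod_cast hs)
    (Eventually.of_forall fun z => ?_) ?_
  · rw [Real.norm_of_nonneg (Real.rpow_nonneg (norm_nonneg _) _), one_mul]
  · exact (continuous_norm.measurable.pow_const _).aestronglyMeasurable

/-- Hence integrable on every bounded measurable set. [folklore] -/
theorem integrableOn_norm_rpow_neg_of_subset (hd : 1 ≤ d) {s : ℝ} (hs : s < d)
    {S : Set (EuclideanSpace ℝ (Fin d))} {r : ℝ} (hS : S ⊆ ball 0 r) :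
    IntegrableOn (fun z : EuclideanSpace ℝ (Fin d) => ‖z‖ ^ (-s)) S volume :=
  (integrableOn_norm_rpow_neg_ball hd hs r).mono_set hS

/-- Translated dominators: for `S` measurable and bounded,
`y ↦ G · 𝟙_S(y - x) ‖y - x‖^{-s}` is integrable with integral `G ∫_S ‖z‖^{-s} dz`
(right-invariance of Lebesgue measure). [folklore] -/
theorem integrable_indicator_comp_sub (hd : 1 ≤ d) {s : ℝ} (hs : s < d)
    {S : Set (EuclideanSpace ℝ (Fin d))} (hSm : MeasurableSet S) {r : ℝ} (hS : S ⊆ ball 0 r)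
    (G : ℝ) (x : EuclideanSpace ℝ (Fin d)) :
    Integrable (fun y : EuclideanSpace ℝ (Fin d) =>
      G * S.indicator (fun z : EuclideanSpace ℝ (Fin d) => ‖z‖ ^ (-s)) (y - x)) volume ∧
    ∫ y, G * S.indicator (fun z : EuclideanSpace ℝ (Fin d) => ‖z‖ ^ (-s)) (y - x) =
      G * ∫ z in S, ‖z‖ ^ (-s) := by
  have hint :
      Integrable (S.indicator fun z : EuclideanSpace ℝ (Fin d) => ‖z‖ ^ (-s)) volume :=
    (integrable_indicator_iff hSm).2 (integrableOn_norm_rpow_neg_of_subset hd hs hS)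
  refine ⟨(hint.comp_sub_right x).const_mul G, ?_⟩
  rw [integral_const_mul]
  congr 1
  rw [integral_sub_right_eq_self
      (S.indicator fun z : EuclideanSpace ℝ (Fin d) => ‖z‖ ^ (-s)) x, integral_indicator hSm]

end Riesz

/-! ### The kernel bound on the two-point function -/

section KernelBound

variable {d : ℕ} {μ : Measure (FieldConfig (EuclideanSpace ℝ (Fin d)))}
  {S₂ : EuclideanSpace ℝ (Fin d) → EuclideanSpace ℝ (Fin d) → ℝ} {C s : ℝ}

/-- **The basic estimate.** Under the kernel representation and the bound
`|S₂| ≤ C ‖x-y‖^{-s}`: if for every `x` with `f x ≠ 0` the function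
`y ↦ ‖y - x‖^{-s} |g y|` is dominated by an integrable `D x` with `∫ D x ≤ M`, then
`|⟨ω(f)ω(g)⟩| ≤ C M ‖f‖₁`. [folklore] -/
theorem abs_twoPoint_le_of_dominated (hC : 0 ≤ C)
    (hrep : ∀ f g : 𝓢(EuclideanSpace ℝ (Fin d), ℝ),
      twoPoint μ f g = ∫ x, ∫ y, S₂ x y * f x * g y)
    (hS : ∀ x y, |S₂ x y| ≤ C * ‖x - y‖ ^ (-s))
    (f g : 𝓢(EuclideanSpace ℝ (Fin d), ℝ)) {M : ℝ}
    (D : EuclideanSpace ℝ (Fin d) → EuclideanSpace ℝ (Fin d) → ℝ)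
    (hDi : ∀ x, f x ≠ 0 → Integrable (D x) volume)
    (hDb : ∀ x, f x ≠ 0 → ∀ y, ‖y - x‖ ^ (-s) * |g y| ≤ D x y)
    (hDM : ∀ x, f x ≠ 0 → ∫ y, D x y ≤ M) :
    |twoPoint μ f g| ≤ C * M * ∫ x, |f x| := by
  rw [hrep f g]
  refine abs_integral_le_of_pointwise (fun x => ?_) f.integrable
  rcases eq_or_ne (f x) 0 with hx | hx
  · simp [hx]
  have h := abs_integral_mul_mul_le (ν := volume) (K := fun y => S₂ x y)
    (B := fun y => ‖y - x‖ ^ (-s)) (g := fun y => g y) (D := D x) (a := f x) hC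
    (fun y => by rw [norm_sub_rev]; exact hS x y) (fun _ => hDb x hx) (hDi x hx)
  calc |∫ y, S₂ x y * f x * g y| ≤ C * |f x| * ∫ y, D x y := h
    _ ≤ C * |f x| * M := mul_le_mul_of_nonneg_left (hDM x hx) (by positivity)
    _ = C * M * |f x| := by ring

/-- **Continuity estimate.** For Schwartz `f, φ` with `|φ| ≤ G`:
`|⟨ω(f)ω(φ)⟩| ≤ C (G c₁ + ‖φ‖₁) ‖f‖₁` with
`c₁ = ∫_{B(0,1)} ‖z‖^{-s} dz` (`0 ≤ s < d`). [folklore] -/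
theorem abs_twoPoint_le_of_sup (hd : 1 ≤ d) (hs0 : 0 ≤ s) (hsd : s < d) (hC : 0 ≤ C)
    (hrep : ∀ f g : 𝓢(EuclideanSpace ℝ (Fin d), ℝ),
      twoPoint μ f g = ∫ x, ∫ y, S₂ x y * f x * g y)
    (hS : ∀ x y, |S₂ x y| ≤ C * ‖x - y‖ ^ (-s))
    (f φ : 𝓢(EuclideanSpace ℝ (Fin d), ℝ)) {G : ℝ} (hG0 : 0 ≤ G)
    (hG : ∀ y, |φ y| ≤ G) :
    |twoPoint μ f φ| ≤
      C * (G * (∫ z in ball (0 : EuclideanSpace ℝ (Fin d)) 1, ‖z‖ ^ (-s)) + ∫ y, |φ y|) *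
        ∫ x, |f x| := by
  set D : EuclideanSpace ℝ (Fin d) → EuclideanSpace ℝ (Fin d) → ℝ := fun x y =>
    G * (ball (0 : EuclideanSpace ℝ (Fin d)) 1).indicator
      (fun z : EuclideanSpace ℝ (Fin d) => ‖z‖ ^ (-s)) (y - x) + |φ y| with hD
  have hball : ball (0 : EuclideanSpace ℝ (Fin d)) 1 ⊆ ball 0 1 := Subset.rfl
  refine abs_twoPoint_le_of_dominated hC hrep hS f φ D (fun x _ => ?_)
    (fun x _ y => ?_) (fun x _ => ?_)
  · exact (integrable_indicator_comp_sub hd hsd measurableSet_ball hball G x).1.add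
      φ.integrable.abs
  · -- pointwise domination
    have hind0 : 0 ≤ (ball (0 : EuclideanSpace ℝ (Fin d)) 1).indicator
        (fun z : EuclideanSpace ℝ (Fin d) => ‖z‖ ^ (-s)) (y - x) :=
      Set.indicator_nonneg (fun z _ => Real.rpow_nonneg (norm_nonneg z) _) _
    by_cases hy : ‖y - x‖ < 1
    · have hmem : y - x ∈ ball (0 : EuclideanSpace ℝ (Fin d)) 1 := mem_ball_zero_iff.2 hy
      simp only [hD, Set.indicator_of_mem hmem]
      have h1 : ‖y - x‖ ^ (-s) * |φ y| ≤ ‖y - x‖ ^ (-s) * G :=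
        mul_le_mul_of_nonneg_left (hG y) (Real.rpow_nonneg (norm_nonneg _) _)
      linarith [abs_nonneg (φ y)]
    · have hle : ‖y - x‖ ^ (-s) ≤ 1 :=
        Real.rpow_le_one_of_one_le_of_nonpos (not_lt.1 hy) (by linarith)
      have h1 : ‖y - x‖ ^ (-s) * |φ y| ≤ 1 * |φ y| :=
        mul_le_mul_of_nonneg_right hle (abs_nonneg _)
      simp only [hD]
      have h2 : 0 ≤ G * (ball (0 : EuclideanSpace ℝ (Fin d)) 1).indicator
          (fun z : EuclideanSpace ℝ (Fin d) => ‖z‖ ^ (-s)) (y - x) := mul_nonneg hG0 hind0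
      linarith
  · simp only [hD]
    rw [integral_add (integrable_indicator_comp_sub hd hsd measurableSet_ball hball G x).1
      φ.integrable.abs, (integrable_indicator_comp_sub hd hsd measurableSet_ball hball G x).2]

end KernelBound

/-! ### Reduction to compactly supported test functions -/

section Cutoff

variable {d : ℕ}

/-- The cut-offs `W_R = latticeWindow id R` of `SchwartzPartition` (products of one-dimensional
windows in the coordinates of `ℝᵈ`) have compact support: they vanish off the closed ball of
radius `√d (R + 1)`. [folklore] -/
theorem hasCompactSupport_latticeWindow (R : ℕ) :
    HasCompactSupport
      (latticeWindow (ContinuousLinearEquiv.refl ℝ (EuclideanSpace ℝ (Fin d))) R) := by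
  refine HasCompactSupport.intro
    (isCompact_closedBall (0 : EuclideanSpace ℝ (Fin d)) (√d * (R + 1))) fun y hy => ?_
  rw [mem_closedBall_zero_iff, not_le] at hy
  -- some coordinate is large
  obtain ⟨c, hc⟩ : ∃ c : Fin d, (R : ℝ) + 1 ≤ |y c| := by
    by_contra h
    push Not at h
    have h' := EuclideanSpace.norm_le_sqrt_card_mul y (by positivity : (0 : ℝ) ≤ R + 1)
      fun c => (h c).le
    rw [Fintype.card_fin] at h'
    exact absurd h' (not_le.2 hy)
  -- the one-dimensional window `w_R` vanishes outside `(-R-1, R+1)`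
  have hzero : ∀ t : ℝ, (R : ℝ) + 1 ≤ |t| → pouWindow R t = 0 := by
    intro t ht
    have hR : (0 : ℝ) ≤ R := Nat.cast_nonneg R
    rcases le_abs'.1 ht with h | h
    · rw [pouWindow, Real.smoothTransition.zero_of_nonpos (by linarith),
        Real.smoothTransition.zero_of_nonpos (by linarith), sub_zero]
    · rw [pouWindow, Real.smoothTransition.one_of_one_le (by linarith),
        Real.smoothTransition.one_of_one_le (by linarith), sub_self]
  unfold latticeWindow
  refine Finset.prod_eq_zero (Finset.mem_univ c) ?_
  exact hzero _ (by simpa using hc)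

/-- `W_R φ → φ` in `𝒮` (the tree's `tendsto_latticeWindow_smul`, real scalars). [folklore] -/
theorem tendsto_latticeWindow_smul_real (φ : 𝓢(EuclideanSpace ℝ (Fin d), ℝ)) :
    Tendsto (fun R : ℕ => SchwartzMap.smulLeftCLM ℝ
      (latticeWindow (ContinuousLinearEquiv.refl ℝ (EuclideanSpace ℝ (Fin d))) R) φ) atTop
      (𝓝 φ) :=
  tendsto_latticeWindow_smul (𝕜 := ℝ)
    (ContinuousLinearEquiv.refl ℝ (EuclideanSpace ℝ (Fin d))) φ

/-- `W_R φ` has compact support. [folklore] -/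
theorem hasCompactSupport_latticeWindow_smul (R : ℕ)
    (φ : 𝓢(EuclideanSpace ℝ (Fin d), ℝ)) :
    HasCompactSupport (SchwartzMap.smulLeftCLM ℝ
      (latticeWindow (ContinuousLinearEquiv.refl ℝ (EuclideanSpace ℝ (Fin d))) R) φ) :=
  IsCompact.of_isClosed_subset (hasCompactSupport_latticeWindow R) (isClosed_tsupport _)
    ((SchwartzMap.tsupport_smulLeftCLM_subset (F := ℝ) _ φ).trans inter_subset_right)

/-- Along a sequence `c_R → φ` in `𝒮`, `c_R - φ → 0` in sup norm … [folklore] -/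
theorem tendsto_seminorm_sub_of_tendsto {c : ℕ → 𝓢(EuclideanSpace ℝ (Fin d), ℝ)}
    {φ : 𝓢(EuclideanSpace ℝ (Fin d), ℝ)} (hc : Tendsto c atTop (𝓝 φ)) :
    Tendsto (fun R : ℕ => SchwartzMap.seminorm ℝ 0 0 (c R - φ)) atTop (𝓝 0) := by
  have h0 : Tendsto (fun R : ℕ => c R - φ) atTop (𝓝 0) := by
    simpa using hc.sub_const φ
  have hcont :
      Continuous (SchwartzMap.seminorm ℝ 0 0 : 𝓢(EuclideanSpace ℝ (Fin d), ℝ) → ℝ) :=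
    (schwartz_withSeminorms ℝ (EuclideanSpace ℝ (Fin d)) ℝ).continuous_seminorm (0, 0)
  have h := (hcont.tendsto 0).comp h0
  rw [map_zero] at h
  exact h

/-- … and in `L¹` (Mathlib's `SchwartzMap.toLpCLM`). [folklore] -/
theorem tendsto_integral_abs_sub_of_tendsto {c : ℕ → 𝓢(EuclideanSpace ℝ (Fin d), ℝ)}
    {φ : 𝓢(EuclideanSpace ℝ (Fin d), ℝ)} (hc : Tendsto c atTop (𝓝 φ)) :
    Tendsto (fun R : ℕ => ∫ y, |(c R - φ) y|) atTop (𝓝 0) := by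
  have h0 : Tendsto (fun R : ℕ => c R - φ) atTop (𝓝 0) := by
    simpa using hc.sub_const φ
  have h1 : Tendsto (fun R : ℕ => SchwartzMap.toLpCLM ℝ ℝ 1
      (volume : Measure (EuclideanSpace ℝ (Fin d))) (c R - φ)) atTop (𝓝 0) := by
    have h := ((SchwartzMap.toLpCLM ℝ ℝ 1
      (volume : Measure (EuclideanSpace ℝ (Fin d)))).continuous.tendsto 0).comp h0
    rw [map_zero] at h
    exact h
  have h2 := h1.norm
  rw [norm_zero] at h2
  refine h2.congr fun R => ?_
  rw [SchwartzMap.toLpCLM_apply, SchwartzMap.norm_toLp_one]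
  simp only [Real.norm_eq_abs]

variable {μ : Measure (FieldConfig (EuclideanSpace ℝ (Fin d)))}
  {S₂ : EuclideanSpace ℝ (Fin d) → EuclideanSpace ℝ (Fin d) → ℝ} {C s : ℝ}

/-- **Continuity of the two-point function** along a sequence `c_R → φ` in `𝒮`, in each slot:
`|⟨ω(f)ω(c_R - φ)⟩| ≤ C (p₀₀(c_R - φ) c₁ + ‖c_R - φ‖₁) ‖f‖₁ → 0` and
symmetrically. [folklore] -/
theorem tendsto_twoPoint_of_tendsto (hd : 1 ≤ d) (hs0 : 0 ≤ s) (hsd : s < d) (hC : 0 ≤ C)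
    (h2 : ∀ f : 𝓢(EuclideanSpace ℝ (Fin d), ℝ),
      MemLp (fun w : FieldConfig (EuclideanSpace ℝ (Fin d)) => w f) 2 μ)
    (hrep : ∀ f g : 𝓢(EuclideanSpace ℝ (Fin d), ℝ),
      twoPoint μ f g = ∫ x, ∫ y, S₂ x y * f x * g y)
    (hS : ∀ x y, |S₂ x y| ≤ C * ‖x - y‖ ^ (-s))
    (f : 𝓢(EuclideanSpace ℝ (Fin d), ℝ)) {c : ℕ → 𝓢(EuclideanSpace ℝ (Fin d), ℝ)}
    {φ : 𝓢(EuclideanSpace ℝ (Fin d), ℝ)}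
    (hc : Tendsto c atTop (𝓝 φ)) :
    Tendsto (fun R : ℕ => twoPoint μ f (c R)) atTop (𝓝 (twoPoint μ f φ)) ∧
    Tendsto (fun R : ℕ => twoPoint μ (c R) f) atTop (𝓝 (twoPoint μ φ f)) := by
  set c₁ : ℝ := ∫ z in ball (0 : EuclideanSpace ℝ (Fin d)) 1, ‖z‖ ^ (-s)
  have hsem := tendsto_seminorm_sub_of_tendsto hc
  have hL1 := tendsto_integral_abs_sub_of_tendsto hc
  have hsup : ∀ (ψ : 𝓢(EuclideanSpace ℝ (Fin d), ℝ)) y,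
      |ψ y| ≤ SchwartzMap.seminorm ℝ 0 0 ψ :=
    fun ψ y => by rw [← Real.norm_eq_abs]; exact SchwartzMap.norm_le_seminorm ℝ ψ y
  constructor
  · have hbound : ∀ R : ℕ, |twoPoint μ f (c R) - twoPoint μ f φ| ≤
        C * (SchwartzMap.seminorm ℝ 0 0 (c R - φ) * c₁ + ∫ y, |(c R - φ) y|) *
          ∫ x, |f x| := by
      intro R
      rw [← twoPoint_sub_right h2]
      exact abs_twoPoint_le_of_sup hd hs0 hsd hC hrep hS f (c R - φ) (apply_nonneg _ _) (hsup _)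
    have hlim : Tendsto (fun R : ℕ =>
        C * (SchwartzMap.seminorm ℝ 0 0 (c R - φ) * c₁ + ∫ y, |(c R - φ) y|) * ∫ x, |f x|)
          atTop (𝓝 0) := by
      have := ((hsem.mul_const c₁).add hL1).const_mul C |>.mul_const (∫ x, |f x|)
      simpa using this
    have h := squeeze_zero_norm (fun R => by rw [Real.norm_eq_abs]; exact hbound R) hlim
    have h' := h.add_const (twoPoint μ f φ)
    simpa using h'
  · have hbound : ∀ R : ℕ, |twoPoint μ (c R) f - twoPoint μ φ f| ≤
        C * (SchwartzMap.seminorm ℝ 0 0 f * c₁ + ∫ y, |f y|) * ∫ x, |(c R - φ) x| := by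
      intro R
      rw [← twoPoint_sub_left h2]
      exact abs_twoPoint_le_of_sup hd hs0 hsd hC hrep hS (c R - φ) f (apply_nonneg _ _) (hsup _)
    have hlim : Tendsto (fun R : ℕ =>
        C * (SchwartzMap.seminorm ℝ 0 0 f * c₁ + ∫ y, |f y|) * ∫ x, |(c R - φ) x|)
          atTop (𝓝 0) := by
      have := hL1.const_mul (C * (SchwartzMap.seminorm ℝ 0 0 f * c₁ + ∫ y, |f y|))
      simpa using this
    have h := squeeze_zero_norm (fun R => by rw [Real.norm_eq_abs]; exact hbound R) hlim
    have h' := h.add_const (twoPoint μ φ f)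
    simpa using h'

/-- **Reduction to compact supports.** A non-degenerate pair may be replaced by a compactly
supported one (cut both functions off with `W_R`, `R` large). [folklore] -/
theorem exists_hasCompactSupport_twoPoint_ne_zero (hd : 1 ≤ d) (hs0 : 0 ≤ s) (hsd : s < d)
    (hC : 0 ≤ C)
    (h2 : ∀ f : 𝓢(EuclideanSpace ℝ (Fin d), ℝ),
      MemLp (fun w : FieldConfig (EuclideanSpace ℝ (Fin d)) => w f) 2 μ)
    (hrep : ∀ f g : 𝓢(EuclideanSpace ℝ (Fin d), ℝ),
      twoPoint μ f g = ∫ x, ∫ y, S₂ x y * f x * g y)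
    (hS : ∀ x y, |S₂ x y| ≤ C * ‖x - y‖ ^ (-s))
    {f₀ g₀ : 𝓢(EuclideanSpace ℝ (Fin d), ℝ)} (hne : twoPoint μ f₀ g₀ ≠ 0) :
    ∃ f g : 𝓢(EuclideanSpace ℝ (Fin d), ℝ),
      HasCompactSupport f ∧ HasCompactSupport g ∧ twoPoint μ f g ≠ 0 := by
  -- cut `g₀`
  obtain ⟨R₁, hR₁⟩ := ((tendsto_twoPoint_of_tendsto hd hs0 hsd hC h2 hrep hS f₀
    (tendsto_latticeWindow_smul_real g₀)).1.eventually_ne hne).exists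
  -- cut `f₀`
  obtain ⟨R₂, hR₂⟩ := ((tendsto_twoPoint_of_tendsto hd hs0 hsd hC h2 hrep hS _
    (tendsto_latticeWindow_smul_real f₀)).2.eventually_ne hR₁).exists
  exact ⟨_, _, hasCompactSupport_latticeWindow_smul R₂ f₀,
    hasCompactSupport_latticeWindow_smul R₁ g₀, hR₂⟩

end Cutoff

/-! ### Slab decomposition of compactly supported test functions -/

section Slab

variable {d : ℕ}

/-- `ρ t ≠ 0` forces `t ∈ [-1, 1]`. [folklore] -/
theorem mem_Icc_of_pouBump_ne_zero {t : ℝ} (h : pouBump t ≠ 0) : t ∈ Icc (-1 : ℝ) 1 :=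
  tsupport_pouBump_subset (subset_tsupport _ (Function.mem_support.2 h))

/-- **The slab pieces.** For a compactly supported Schwartz `φ`, a coordinate `i₀` and a width
parameter `L`, the functions `θ_k φ`, `θ_k(y) = ρ(L y_{i₀} - k)` (`k ∈ ℤ`), are Schwartz
functions (smooth with compact support). [folklore] -/
theorem exists_slab_family (i₀ : Fin d) (L : ℝ) (φ : 𝓢(EuclideanSpace ℝ (Fin d), ℝ))
    (hφ : HasCompactSupport φ) :
    ∃ F : ℤ → 𝓢(EuclideanSpace ℝ (Fin d), ℝ),
      ∀ k y, F k y = pouBump (L * y i₀ - k) * φ y := by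
  have hsm : ∀ k : ℤ,
      ContDiff ℝ ∞ fun y : EuclideanSpace ℝ (Fin d) => pouBump (L * y i₀ - k) * φ y :=
    fun k => (contDiff_pouBump.comp ((contDiff_const.mul
      (EuclideanSpace.proj (𝕜 := ℝ) i₀).contDiff).sub contDiff_const)).mul (φ.smooth ⊤)
  have hcs : ∀ k : ℤ,
      HasCompactSupport fun y : EuclideanSpace ℝ (Fin d) => pouBump (L * y i₀ - k) * φ y :=
    fun k => hφ.mul_left
  exact ⟨fun k => (hcs k).toSchwartzMap (hsm k), fun k y => rfl⟩

/-- A slab piece has compact support. [folklore] -/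
theorem hasCompactSupport_of_slab {i₀ : Fin d} {L : ℝ} {k : ℤ}
    {φ F : 𝓢(EuclideanSpace ℝ (Fin d), ℝ)}
    (hF : ∀ y, F y = pouBump (L * y i₀ - k) * φ y) (hφ : HasCompactSupport φ) :
    HasCompactSupport F := by
  have : (⇑F : EuclideanSpace ℝ (Fin d) → ℝ) = fun y => pouBump (L * y i₀ - k) * φ y :=
    funext hF
  rw [this]
  exact hφ.mul_left

/-- The support of a slab piece lies in the closed slab `{L y_{i₀} - k ∈ [-1, 1]}`.
[folklore] -/
theorem tsupport_subset_of_slab {i₀ : Fin d} {L : ℝ} {k : ℤ}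
    {φ F : 𝓢(EuclideanSpace ℝ (Fin d), ℝ)}
    (hF : ∀ y, F y = pouBump (L * y i₀ - k) * φ y) :
    tsupport F ⊆ {y | L * y i₀ - k ∈ Icc (-1 : ℝ) 1} := by
  have hcl : IsClosed {y : EuclideanSpace ℝ (Fin d) | L * y i₀ - k ∈ Icc (-1 : ℝ) 1} :=
    isClosed_Icc.preimage
      ((continuous_const.mul (EuclideanSpace.proj (𝕜 := ℝ) i₀).continuous).sub
        continuous_const)
  refine closure_minimal (fun y hy => ?_) hcl
  rw [Function.mem_support, hF] at hy
  exact mem_Icc_of_pouBump_ne_zero (left_ne_zero_of_mul hy)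

/-- Slab pieces with `|k - m| > 2` have disjoint supports. [folklore] -/
theorem disjoint_tsupport_of_slab {i₀ : Fin d} {L : ℝ} {k m : ℤ} (hkm : 2 < |k - m|)
    {φ ψ F G : 𝓢(EuclideanSpace ℝ (Fin d), ℝ)}
    (hF : ∀ y, F y = pouBump (L * y i₀ - k) * φ y)
    (hG : ∀ y, G y = pouBump (L * y i₀ - m) * ψ y) :
    Disjoint (tsupport F) (tsupport G) := by
  refine Set.disjoint_left.2 fun y hy1 hy2 => ?_
  have h1 := tsupport_subset_of_slab hF hy1
  have h2 := tsupport_subset_of_slab hG hy2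
  simp only [mem_setOf_eq, mem_Icc] at h1 h2
  have h3 : |((k : ℝ)) - m| ≤ 2 := by
    rw [abs_le]; constructor <;> linarith [h1.1, h1.2, h2.1, h2.2]
  have h4 : |k - m| ≤ 2 := by exact_mod_cast h3
  exact absurd h4 (not_le.2 hkm)

/-- **Reassembly**: `∑_{|k| ≤ N} θ_k φ = φ` once the slabs cover the support
(`|L y_{i₀}| ≤ N` on `supp φ`; telescoping `sum_Icc_pouBump`). [folklore] -/
theorem sum_slab_eq {i₀ : Fin d} {L : ℝ} {N : ℕ} {φ : 𝓢(EuclideanSpace ℝ (Fin d), ℝ)}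
    {F : ℤ → 𝓢(EuclideanSpace ℝ (Fin d), ℝ)}
    (hF : ∀ k y, F k y = pouBump (L * y i₀ - k) * φ y)
    (hN : ∀ y, φ y ≠ 0 → |L * y i₀| ≤ N) :
    ∑ k ∈ Finset.Icc (-(N : ℤ)) N, F k = φ := by
  ext y
  rw [sum_apply]
  simp only [hF]
  rw [← Finset.sum_mul]
  rcases eq_or_ne (φ y) 0 with hy | hy
  · simp [hy]
  · rw [sum_Icc_pouBump N (L * y i₀), pouWindow_eq_one (hN y hy), one_mul]

/-- `∑_{|k| ≤ N} |θ_k φ| = |φ|` pointwise under the same covering condition. [folklore] -/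
theorem sum_abs_slab_eq {i₀ : Fin d} {L : ℝ} {N : ℕ}
    {φ : 𝓢(EuclideanSpace ℝ (Fin d), ℝ)} {F : ℤ → 𝓢(EuclideanSpace ℝ (Fin d), ℝ)}
    (hF : ∀ k y, F k y = pouBump (L * y i₀ - k) * φ y)
    (hN : ∀ y, φ y ≠ 0 → |L * y i₀| ≤ N) (y : EuclideanSpace ℝ (Fin d)) :
    ∑ k ∈ Finset.Icc (-(N : ℤ)) N, |F k y| = |φ y| := by
  simp only [hF, abs_mul, abs_of_nonneg (pouBump_nonneg _)]
  rw [← Finset.sum_mul]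
  rcases eq_or_ne (φ y) 0 with hy | hy
  · simp [hy]
  · rw [sum_Icc_pouBump N (L * y i₀), pouWindow_eq_one (hN y hy), one_mul]

end Slab

/-! ### The slab sets and their shrinking Riesz mass -/

section SlabSet

variable {d : ℕ}

/-- The slab sets `S_δ = {‖z‖ ≤ 2R, |z_{i₀}| ≤ δ}` are closed. [folklore] -/
theorem isClosed_slabSet (i₀ : Fin d) (R δ : ℝ) :
    IsClosed {z : EuclideanSpace ℝ (Fin d) | ‖z‖ ≤ 2 * R ∧ |z i₀| ≤ δ} := by
  simp only [setOf_and]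
  refine (isClosed_le continuous_norm continuous_const).inter (isClosed_le ?_ continuous_const)
  exact (EuclideanSpace.proj (𝕜 := ℝ) i₀).continuous.abs

/-- `S_δ ⊆ B(0, 2R + 1)`. [folklore] -/
theorem slabSet_subset_ball (i₀ : Fin d) (R δ : ℝ) :
    {z : EuclideanSpace ℝ (Fin d) | ‖z‖ ≤ 2 * R ∧ |z i₀| ≤ δ} ⊆
      ball 0 (2 * R + 1) :=
  fun z hz => mem_ball_zero_iff.2 (by linarith [hz.1])

/-- **The Riesz mass of the slabs tends to zero**: `∫_{S_{4/(n+1)}} ‖z‖^{-s} dz → 0` (the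
slabs decrease to a subset of the hyperplane `z_{i₀} = 0`, which is Lebesgue-null). [folklore] -/
theorem tendsto_integral_slabSet (hd : 1 ≤ d) {s : ℝ} (hsd : s < d) (i₀ : Fin d) (R : ℝ) :
    Tendsto (fun n : ℕ =>
      ∫ z in {z : EuclideanSpace ℝ (Fin d) |
        ‖z‖ ≤ 2 * R ∧ |z i₀| ≤ 4 * (1 / ((n : ℝ) + 1))}, ‖z‖ ^ (-s))
      atTop (𝓝 0) := by
  set S : ℕ → Set (EuclideanSpace ℝ (Fin d)) := fun n =>
    {z : EuclideanSpace ℝ (Fin d) | ‖z‖ ≤ 2 * R ∧ |z i₀| ≤ 4 * (1 / ((n : ℝ) + 1))}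
  have hanti : Antitone S := by
    intro m n hmn z hz
    refine ⟨hz.1, hz.2.trans ?_⟩
    have hmn' : (m : ℝ) + 1 ≤ (n : ℝ) + 1 := by
      have : (m : ℝ) ≤ n := by exact_mod_cast hmn
      linarith
    exact mul_le_mul_of_nonneg_left (one_div_le_one_div_of_le (by positivity) hmn') (by norm_num)
  have hmeas : ∀ n, MeasurableSet (S n) := fun n => (isClosed_slabSet i₀ R _).measurableSet
  have hint :
      ∃ n, IntegrableOn (fun z : EuclideanSpace ℝ (Fin d) => ‖z‖ ^ (-s)) (S n) volume :=
    ⟨0, integrableOn_norm_rpow_neg_of_subset hd hsd (slabSet_subset_ball i₀ R _)⟩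
  have h := tendsto_setIntegral_of_antitone hmeas hanti hint
  -- the intersection is null
  have hsub : (⋂ n, S n) ⊆ (LinearMap.ker (EuclideanSpace.proj (𝕜 := ℝ) i₀).toLinearMap :
      Submodule ℝ (EuclideanSpace ℝ (Fin d))) := by
    intro z hz
    rw [mem_iInter] at hz
    have hle : ∀ n : ℕ, |z i₀| ≤ 4 * (1 / ((n : ℝ) + 1)) := fun n => (hz n).2
    have hlim : Tendsto (fun n : ℕ => 4 * (1 / ((n : ℝ) + 1))) atTop (𝓝 0) := by
      simpa using tendsto_one_div_add_atTop_nhds_zero_nat.const_mul (4 : ℝ)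
    have h0 : |z i₀| ≤ 0 := ge_of_tendsto' hlim hle
    have hz0 : z i₀ = 0 := abs_nonpos_iff.1 h0
    simpa [LinearMap.mem_ker] using hz0
  have hker : (LinearMap.ker (EuclideanSpace.proj (𝕜 := ℝ) i₀).toLinearMap :
      Submodule ℝ (EuclideanSpace ℝ (Fin d))) ≠ ⊤ := by
    intro htop
    have hmem : EuclideanSpace.single i₀ (1 : ℝ) ∈
        (LinearMap.ker (EuclideanSpace.proj (𝕜 := ℝ) i₀).toLinearMap :
          Submodule ℝ (EuclideanSpace ℝ (Fin d))) := by
      rw [htop]; exact Submodule.mem_top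
    rw [LinearMap.mem_ker] at hmem
    simp at hmem
  have hnull : volume (⋂ n, S n) = 0 :=
    measure_mono_null hsub (Measure.addHaar_submodule volume _ hker)
  have hzero : ∫ z in ⋂ n, S n, ‖z‖ ^ (-s) = (0 : ℝ) := setIntegral_measure_zero _ hnull
  rw [hzero] at h
  exact h

end SlabSet

/-! ### The disjointly supported witness -/

section Witness

variable {d : ℕ} {μ : Measure (FieldConfig (EuclideanSpace ℝ (Fin d)))}
  {S₂ : EuclideanSpace ℝ (Fin d) → EuclideanSpace ℝ (Fin d) → ℝ} {C s : ℝ}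

/-- **The slab estimate.** For compactly supported `f, g` (supports in `B̄(0, R)`, `|g| ≤ G`) and
slab pieces `f_k = θ_k f`, `g_m = θ_m g` of width parameter `L = n + 1` with `|k - m| ≤ 2`:
`|⟨ω(f_k)ω(g_m)⟩| ≤ C G Ψₙ ‖f_k‖₁`, `Ψₙ = ∫_{S_{4/(n+1)}} ‖z‖^{-s}`.
[folklore] -/
theorem abs_twoPoint_slab_le (hd : 1 ≤ d) (hsd : s < d) (hC : 0 ≤ C)
    (hrep : ∀ f g : 𝓢(EuclideanSpace ℝ (Fin d), ℝ),
      twoPoint μ f g = ∫ x, ∫ y, S₂ x y * f x * g y)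
    (hS : ∀ x y, |S₂ x y| ≤ C * ‖x - y‖ ^ (-s)) (i₀ : Fin d) {R G : ℝ} (hG0 : 0 ≤ G)
    {f g : 𝓢(EuclideanSpace ℝ (Fin d), ℝ)} (hfR : tsupport f ⊆ closedBall 0 R)
    (hgR : tsupport g ⊆ closedBall 0 R) (hG : ∀ y, |g y| ≤ G) (n : ℕ) {k m : ℤ}
    (hkm : |k - m| ≤ 2) {Fk Gm : 𝓢(EuclideanSpace ℝ (Fin d), ℝ)}
    (hFk : ∀ y, Fk y = pouBump (((n : ℝ) + 1) * y i₀ - k) * f y)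
    (hGm : ∀ y, Gm y = pouBump (((n : ℝ) + 1) * y i₀ - m) * g y) :
    |twoPoint μ Fk Gm| ≤
      C * (G * ∫ z in {z : EuclideanSpace ℝ (Fin d) |
        ‖z‖ ≤ 2 * R ∧ |z i₀| ≤ 4 * (1 / ((n : ℝ) + 1))}, ‖z‖ ^ (-s)) *
        ∫ x, |Fk x| := by
  set L : ℝ := (n : ℝ) + 1
  have hL0 : 0 < L := by positivity
  set S : Set (EuclideanSpace ℝ (Fin d)) :=
    {z : EuclideanSpace ℝ (Fin d) | ‖z‖ ≤ 2 * R ∧ |z i₀| ≤ 4 * (1 / L)}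
  have hSm : MeasurableSet S := (isClosed_slabSet i₀ R _).measurableSet
  have hSb := slabSet_subset_ball i₀ R (4 * (1 / L))
  set D : EuclideanSpace ℝ (Fin d) → EuclideanSpace ℝ (Fin d) → ℝ := fun x y =>
    G * S.indicator (fun z : EuclideanSpace ℝ (Fin d) => ‖z‖ ^ (-s)) (y - x) with hD
  refine abs_twoPoint_le_of_dominated hC hrep hS _ _ D
    (fun x _ => (integrable_indicator_comp_sub hd hsd hSm hSb G x).1) (fun x hx y => ?_)
    (fun x _ => (integrable_indicator_comp_sub hd hsd hSm hSb G x).2.le)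
  -- the pointwise domination on the slab
  rw [hFk] at hx
  rw [hGm]
  have hfx : f x ≠ 0 := right_ne_zero_of_mul hx
  have hθx : pouBump (L * x i₀ - k) ≠ 0 := left_ne_zero_of_mul hx
  rcases eq_or_ne (pouBump (L * y i₀ - m) * g y) 0 with hy | hy
  · rw [hy, abs_zero, mul_zero]
    exact mul_nonneg hG0 (Set.indicator_nonneg (fun z _ => Real.rpow_nonneg (norm_nonneg z) _) _)
  have hgy : g y ≠ 0 := right_ne_zero_of_mul hy
  have hθy : pouBump (L * y i₀ - m) ≠ 0 := left_ne_zero_of_mul hy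
  have hxR : ‖x‖ ≤ R :=
    mem_closedBall_zero_iff.1 (hfR (subset_tsupport _ (Function.mem_support.2 hfx)))
  have hyR : ‖y‖ ≤ R :=
    mem_closedBall_zero_iff.1 (hgR (subset_tsupport _ (Function.mem_support.2 hgy)))
  have h1 := mem_Icc_of_pouBump_ne_zero hθx
  have h2 := mem_Icc_of_pouBump_ne_zero hθy
  rw [mem_Icc] at h1 h2
  have h3 : |((k : ℝ)) - m| ≤ 2 := by exact_mod_cast hkm
  have hmem : y - x ∈ S := by
    refine ⟨?_, ?_⟩
    · calc ‖y - x‖ ≤ ‖y‖ + ‖x‖ := norm_sub_le _ _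
        _ ≤ 2 * R := by linarith
    · have hcoord : (y - x) i₀ = y i₀ - x i₀ := by simp
      rw [hcoord, abs_le]
      rw [abs_le] at h3
      have hLy : L * (y i₀ - x i₀) ≤ 4 := by linarith [h1.1, h1.2, h2.1, h2.2, h3.1, h3.2]
      have hLy' : -4 ≤ L * (y i₀ - x i₀) := by linarith [h1.1, h1.2, h2.1, h2.2, h3.1, h3.2]
      constructor
      · rw [show -(4 * (1 / L)) = -4 / L by ring, div_le_iff₀ hL0]
        linarith
      · rw [show 4 * (1 / L) = 4 / L by ring, le_div_iff₀ hL0]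
        linarith
  simp only [hD, Set.indicator_of_mem hmem]
  have hρ1 : pouBump (L * y i₀ - m) ≤ 1 := by
    unfold pouBump
    linarith [Real.smoothTransition.le_one (L * y i₀ - m + 1),
      Real.smoothTransition.nonneg (L * y i₀ - m)]
  have habs : |pouBump (L * y i₀ - m) * g y| ≤ G := by
    rw [abs_mul, abs_of_nonneg (pouBump_nonneg _)]
    calc pouBump (L * y i₀ - m) * |g y| ≤ 1 * G :=
          mul_le_mul hρ1 (hG y) (abs_nonneg _) zero_le_one
      _ = G := one_mul G
  calc ‖y - x‖ ^ (-s) * |pouBump (L * y i₀ - m) * g y| ≤ ‖y - x‖ ^ (-s) * G :=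
        mul_le_mul_of_nonneg_left habs (Real.rpow_nonneg (norm_nonneg _) _)
    _ = G * ‖y - x‖ ^ (-s) := mul_comm _ _

/-- **The off-diagonal witness.** For compactly supported Schwartz `f, g` with
`⟨ω(f)ω(g)⟩ ≠ 0` there are compactly supported Schwartz `f', g'` with *disjoint* supports
and `⟨ω(f')ω(g')⟩ ≠ 0` (slab decomposition at a sufficiently fine width). [folklore] -/
theorem exists_disjoint_twoPoint_ne_zero (hd : 1 ≤ d) (hsd : s < d) (hC : 0 ≤ C)
    (h2 : ∀ f : 𝓢(EuclideanSpace ℝ (Fin d), ℝ),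
      MemLp (fun w : FieldConfig (EuclideanSpace ℝ (Fin d)) => w f) 2 μ)
    (hrep : ∀ f g : 𝓢(EuclideanSpace ℝ (Fin d), ℝ),
      twoPoint μ f g = ∫ x, ∫ y, S₂ x y * f x * g y)
    (hS : ∀ x y, |S₂ x y| ≤ C * ‖x - y‖ ^ (-s))
    {f g : 𝓢(EuclideanSpace ℝ (Fin d), ℝ)} (hf : HasCompactSupport f)
    (hg : HasCompactSupport g) (hne : twoPoint μ f g ≠ 0) :
    ∃ f' g' : 𝓢(EuclideanSpace ℝ (Fin d), ℝ),
      HasCompactSupport f' ∧ HasCompactSupport g' ∧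
      Disjoint (tsupport f') (tsupport g') ∧ twoPoint μ f' g' ≠ 0 := by
  have hd0 : 0 < d := hd
  set i₀ : Fin d := ⟨0, hd0⟩
  -- a common radius for the supports
  obtain ⟨R, -, hR⟩ := (hf.isCompact.union hg.isCompact).isBounded.subset_closedBall_lt 0
    (0 : EuclideanSpace ℝ (Fin d))
  have hfR : tsupport f ⊆ closedBall 0 R := subset_union_left.trans hR
  have hgR : tsupport g ⊆ closedBall 0 R := subset_union_right.trans hR
  -- a sup bound for `g`
  set G : ℝ := SchwartzMap.seminorm ℝ 0 0 g
  have hG0 : 0 ≤ G := apply_nonneg _ _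
  have hG : ∀ y, |g y| ≤ G := fun y => by
    rw [← Real.norm_eq_abs]; exact SchwartzMap.norm_le_seminorm ℝ g y
  -- choose the width: `Q Ψₙ < |⟨f, g⟩|` with `Q = 5 C G ‖f‖₁`
  set Q : ℝ := 5 * (C * G * ∫ x, |f x|) with hQ
  have hf1 : 0 ≤ ∫ x, |f x| := integral_nonneg fun x => abs_nonneg _
  have hQ0 : 0 ≤ Q := by positivity
  have ht : 0 < |twoPoint μ f g| := abs_pos.2 hne
  have hΨ := tendsto_integral_slabSet hd hsd i₀ R
  obtain ⟨n, hn⟩ := (hΨ.eventually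
    (gt_mem_nhds (show (0 : ℝ) < |twoPoint μ f g| / (Q + 1) by positivity))).exists
  set L : ℝ := (n : ℝ) + 1
  have hL0 : 0 < L := by positivity
  set Ψ : ℝ := ∫ z in {z : EuclideanSpace ℝ (Fin d) |
    ‖z‖ ≤ 2 * R ∧ |z i₀| ≤ 4 * (1 / ((n : ℝ) + 1))}, ‖z‖ ^ (-s)
  have hΨ0 : 0 ≤ Ψ := integral_nonneg fun z => Real.rpow_nonneg (norm_nonneg _) _
  have hQΨ : Q * Ψ < |twoPoint μ f g| := by
    calc Q * Ψ ≤ (Q + 1) * Ψ := by nlinarith [hΨ0]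
      _ < (Q + 1) * (|twoPoint μ f g| / (Q + 1)) := mul_lt_mul_of_pos_left hn (by positivity)
      _ = |twoPoint μ f g| := by field_simp
  -- the index range: `|L y_{i₀}| ≤ N` on `B̄(0, R)`
  obtain ⟨N, hN⟩ := exists_nat_ge (L * R)
  have hcover : ∀ φ : 𝓢(EuclideanSpace ℝ (Fin d), ℝ), tsupport φ ⊆ closedBall 0 R →
      ∀ y, φ y ≠ 0 → |L * y i₀| ≤ N := by
    intro φ hφR y hy
    have hyR : ‖y‖ ≤ R :=
      mem_closedBall_zero_iff.1 (hφR (subset_tsupport _ (Function.mem_support.2 hy)))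
    have hc : |y i₀| ≤ R := by
      calc |y i₀| = ‖y i₀‖ := (Real.norm_eq_abs _).symm
        _ ≤ ‖y‖ := PiLp.norm_apply_le y i₀
        _ ≤ R := hyR
    calc |L * y i₀| = L * |y i₀| := by rw [abs_mul, abs_of_pos hL0]
      _ ≤ L * R := mul_le_mul_of_nonneg_left hc hL0.le
      _ ≤ N := hN
  -- the slab pieces
  obtain ⟨F, hF⟩ := exists_slab_family i₀ L f hf
  obtain ⟨Gm, hGm⟩ := exists_slab_family i₀ L g hg
  set I : Finset ℤ := Finset.Icc (-(N : ℤ)) N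
  have hsumf : ∑ k ∈ I, F k = f := sum_slab_eq hF (hcover f hfR)
  have hsumg : ∑ m ∈ I, Gm m = g := sum_slab_eq hGm (hcover g hgR)
  -- bilinear expansion
  have hexp : twoPoint μ f g = ∑ k ∈ I, ∑ m ∈ I, twoPoint μ (F k) (Gm m) := by
    calc twoPoint μ f g = twoPoint μ (∑ k ∈ I, F k) (∑ m ∈ I, Gm m) := by
          rw [hsumf, hsumg]
      _ = ∑ k ∈ I, twoPoint μ (F k) (∑ m ∈ I, Gm m) := twoPoint_sum_left h2 I F _
      _ = ∑ k ∈ I, ∑ m ∈ I, twoPoint μ (F k) (Gm m) :=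
          Finset.sum_congr rfl fun k _ => twoPoint_sum_right h2 I (F k) Gm
  -- some far pair is non-zero
  by_contra hfar
  push Not at hfar
  have hzero : ∀ k ∈ I, ∀ m ∈ I, ¬ |k - m| ≤ 2 → twoPoint μ (F k) (Gm m) = 0 :=
    fun k _ m _ hkm => hfar (F k) (Gm m) (hasCompactSupport_of_slab (hF k) hf)
      (hasCompactSupport_of_slab (hGm m) hg)
      (disjoint_tsupport_of_slab (not_le.1 hkm) (hF k) (hGm m))
  -- only the near pairs remain
  have hnear : twoPoint μ f g =
      ∑ k ∈ I, ∑ m ∈ I.filter (fun m => |k - m| ≤ 2), twoPoint μ (F k) (Gm m) := by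
    rw [hexp]
    refine Finset.sum_congr rfl fun k hk => ?_
    rw [← Finset.sum_filter_add_sum_filter_not I (fun m => |k - m| ≤ 2)]
    have hz : ∑ m ∈ I.filter (fun m => ¬ |k - m| ≤ 2), twoPoint μ (F k) (Gm m) = 0 :=
      Finset.sum_eq_zero fun m hm => by
        rw [Finset.mem_filter] at hm
        exact hzero k hk m hm.1 hm.2
    rw [hz, add_zero]
  -- estimate the near pairs
  have hpair : ∀ k ∈ I, ∀ m ∈ I.filter (fun m => |k - m| ≤ 2),
      |twoPoint μ (F k) (Gm m)| ≤ C * (G * Ψ) * ∫ x, |F k x| := by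
    intro k _ m hm
    rw [Finset.mem_filter] at hm
    exact abs_twoPoint_slab_le hd hsd hC hrep hS i₀ hG0 hfR hgR hG n hm.2 (hF k) (hGm m)
  have hcard : ∀ k : ℤ, (I.filter (fun m => |k - m| ≤ 2)).card ≤ 5 := by
    intro k
    calc (I.filter (fun m => |k - m| ≤ 2)).card ≤ (Finset.Icc (k - 2) (k + 2)).card := by
          refine Finset.card_le_card fun m hm => ?_
          rw [Finset.mem_filter] at hm
          rw [Finset.mem_Icc]
          have := abs_le.1 hm.2
          constructor <;> omega
      _ = 5 := by simp only [Int.card_Icc]; omega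
  have hbound : |twoPoint μ f g| ≤ Q * Ψ := by
    calc |twoPoint μ f g|
        = |∑ k ∈ I, ∑ m ∈ I.filter (fun m => |k - m| ≤ 2), twoPoint μ (F k) (Gm m)| := by
          rw [← hnear]
      _ ≤ ∑ k ∈ I, |∑ m ∈ I.filter (fun m => |k - m| ≤ 2), twoPoint μ (F k) (Gm m)| :=
          Finset.abs_sum_le_sum_abs _ _
      _ ≤ ∑ k ∈ I, ∑ m ∈ I.filter (fun m => |k - m| ≤ 2), |twoPoint μ (F k) (Gm m)| :=
          Finset.sum_le_sum fun k _ => Finset.abs_sum_le_sum_abs _ _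
      _ ≤ ∑ k ∈ I, ∑ _m ∈ I.filter (fun m => |k - m| ≤ 2),
            C * (G * Ψ) * ∫ x, |F k x| :=
          Finset.sum_le_sum fun k hk => Finset.sum_le_sum fun m hm => hpair k hk m hm
      _ ≤ ∑ k ∈ I, 5 * (C * (G * Ψ) * ∫ x, |F k x|) := by
          refine Finset.sum_le_sum fun k _ => ?_
          rw [Finset.sum_const, nsmul_eq_mul]
          have hFk : 0 ≤ ∫ x, |F k x| := integral_nonneg fun x => abs_nonneg _
          have h0 : 0 ≤ C * (G * Ψ) * ∫ x, |F k x| := by positivity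
          exact mul_le_mul_of_nonneg_right (by exact_mod_cast hcard k) h0
      _ = 5 * (C * (G * Ψ)) * ∑ k ∈ I, ∫ x, |F k x| := by
          rw [Finset.mul_sum]
          refine Finset.sum_congr rfl fun k _ => by ring
      _ = 5 * (C * (G * Ψ)) * ∫ x, |f x| := by
          congr 1
          rw [← integral_finsetSum I (fun k _ => (F k).integrable.abs)]
          exact integral_congr_ae
            (Eventually.of_forall fun x => sum_abs_slab_eq hF (hcover f hfR) x)
      _ = Q * Ψ := by simp only [hQ]; ring
  exact absurd hQΨ (not_lt.2 hbound)

end Witness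

end TwoPointOffDiagonal

open TwoPointOffDiagonal in
/-- **Discharge of `HasBoundedNondegenerateTwoPoint.hasPowerBoundedNondegenerateTwoPoint`.**
On `ℝᵈ`, `2 < d`, A1's bounded non-degenerate two-point function
(`HasBoundedNondegenerateTwoPoint μ`: second moments, kernel representation
`⟨ω(f)ω(g)⟩ = ∫∫ S₂ f g` for all Schwartz `f, g`,
`|S₂(x,y)| ≤ C ‖x-y‖^{-(d-2)}`, and `⟨ω(f₀)ω(g₀)⟩ ≠ 0` for some pair) implies the
off-diagonal power-bounded form `HasPowerBoundedNondegenerateTwoPoint μ` with `s = d - 2`: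
clauses (i)–(iii) are restrictions of the hypotheses, and the off-diagonal non-degeneracy (iv) is
the covering argument of this file — cut the pair off to compact support (continuity of
`⟨ω(f)ω(·)⟩` from the kernel bound, `exists_hasCompactSupport_twoPoint_ne_zero`), then slice both
functions into thin slabs and discard the `O(Ψ) → 0` contribution of neighbouring slabs
(`exists_disjoint_twoPoint_ne_zero`).
The hypothesis is that of Aizenman–Duminil-Copin, Ann. Math. 194 (2021), §1.2 (bounded two-point
function, `|S₂(x,y)| ≤ C/|x-y|^{d-2}`); the implication itself is elementary (folklore).
(Locator: Thm 1.2 and its bounded two-point function hypothesis, §1.2–1.3.)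
[cite: AizenmanDuminilCopinAnnals2021, §1.2–1.3 (hypothesis of Thm 1.2); implication folklore] -/
theorem
    _root_.Literature.MathematicalPhysics.QuantumLattice.HasBoundedNondegenerateTwoPoint.hasPowerBoundedNondegenerateTwoPoint_holds :
    HasBoundedNondegenerateTwoPoint.hasPowerBoundedNondegenerateTwoPoint := by
  intro d μ h hd
  obtain ⟨h2, S₂, hrep, ⟨C, hS⟩, f₀, g₀, hne⟩ := h
  rw [finrank_euclideanSpace_fin] at hS
  -- normalise the constant and the exponent
  set s : ℝ := (d : ℝ) - 2 with hs
  have hd1 : 1 ≤ d := by omega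
  have hd' : (2 : ℝ) < d := by exact_mod_cast hd
  have hs0 : 0 ≤ s := by rw [hs]; linarith
  have hspos : 0 < s := by rw [hs]; linarith
  have hsd : s < d := by rw [hs]; linarith
  set C' : ℝ := max C 0
  have hC' : 0 ≤ C' := le_max_right _ _
  have hS' : ∀ x y, |S₂ x y| ≤ C' * ‖x - y‖ ^ (-s) := fun x y =>
    (hS x y).trans
      (mul_le_mul_of_nonneg_right (le_max_left _ _) (Real.rpow_nonneg (norm_nonneg _) _))
  refine ⟨h2, S₂, s, C', hspos, fun f g _ _ _ => hrep f g, fun x y _ => hS' x y, ?_⟩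
  obtain ⟨f, g, hf, hg, hne'⟩ :=
    exists_hasCompactSupport_twoPoint_ne_zero hd1 hs0 hsd hC' h2 hrep hS' hne
  obtain ⟨f', g', hf', hg', hdisj, hne''⟩ :=
    exists_disjoint_twoPoint_ne_zero hd1 hsd hC' h2 hrep hS' hf hg hne'
  exact ⟨f', g', hf', hg', hdisj, hne''⟩

end Literature.MathematicalPhysics.QuantumFieldTheory
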